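import Literature.Probability.RandomMatrix.ComplexGaussianVector
import Literature.Computability.QuantumComplexity.HaarUnitaryHidingProofs
import HarnessLib

/-!
# Squared norms of complex Gaussian vectors: exponential and Gamma laws

For the standard complex Gaussian `z` (`stdComplexGaussian`, density `π⁻¹e^{−|z|²}`):

* `lintegral_comp_normSq_stdComplexGaussian`, `stdComplexGaussian_map_normSq`: `|z|²` is
  exponentially distributed with mean `1` (`gammaMeasure 1 1`) — polar coordinates in `ℝ²`;
* `gammaMeasure_prod_map_add_exp`: `Gamma(k,1) ∗ Exp(1) = Gamma(k+1,1)` (convolution identity,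
  computed from the densities);
* `gaussianPi_map_sum_normSq`: hence `∑_{i<n} |z_i|² ∼ Gamma(n,1)` for i.i.d. `z_i` (`n ≥ 1`);
* `gaussianPi_sum_map_normSq_pair`: for a vector indexed by `Fin n ⊕ Fin p` the two partial sums
  of squares are independent `Gamma(n,1)`, `Gamma(p,1)`.

These are the "chi-square" facts behind the Beta law of the squared norm of a few coordinates
of a uniformly random point on a complex sphere (file `SphereTruncationTV`).

## References

Standard; e.g. R. J. Muirhead, *Aspects of multivariate statistical theory*, Wiley 1982,
Thm. 1.3.3–1.3.4 (`χ²` laws of Gaussian quadratic forms), adapted to complex Gaussians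
(`|𝒩_ℂ(0,1)|² ∼ Exp(1)`).
-/

open MeasureTheory ProbabilityTheory Complex WithLp Real Set
open scoped ENNReal NNReal

namespace Literature.Probability.RandomMatrix

open Literature.Computability.QuantumComplexity (stdComplexGaussian stdComplexGaussianDensity
  stdComplexGaussian_eq_withDensity continuous_stdComplexGaussianDensity)

/-! ### `|z|²` is exponential -/

/-- The radial integral behind `|z|² ∼ Exp(1)`: for measurable `G ≥ 0`,
`∫ G(r²) · 2r e^{−r²} dr over (0,∞) = ∫ G(t) e^{−t} dt over (0,∞)` (substitution `t = r²`).
[folklore] -/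
theorem lintegral_Ioi_comp_sq_mul (G : ℝ → ℝ≥0∞) :
    ∫⁻ r in Ioi (0:ℝ), ENNReal.ofReal (2 * r) * (G (r ^ 2) * ENNReal.ofReal (Real.exp (-(r ^ 2)))) =
      ∫⁻ t in Ioi (0:ℝ), G t * ENNReal.ofReal (Real.exp (-t)) := by
  have himage : (fun r : ℝ => r ^ 2) '' Ioi (0:ℝ) = Ioi 0 := by
    ext t
    constructor
    · rintro ⟨r, hr, rfl⟩; exact pow_pos (show (0:ℝ) < r from hr) 2
    · intro ht
      exact ⟨Real.sqrt t, Real.sqrt_pos.2 ht, Real.sq_sqrt ht.le⟩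
  have hderiv : ∀ r ∈ Ioi (0:ℝ), HasDerivWithinAt (fun r : ℝ => r ^ 2) (2 * r) (Ioi 0) r := by
    intro r _
    have := (hasDerivAt_pow 2 r).hasDerivWithinAt (s := Ioi 0)
    simpa using this
  have hmono : MonotoneOn (fun r : ℝ => r ^ 2) (Ioi 0) :=
    fun a ha b _ hab => pow_le_pow_left₀ (le_of_lt (show (0:ℝ) < a from ha)) hab 2
  have h := lintegral_image_eq_lintegral_deriv_mul_of_monotoneOn measurableSet_Ioi hderiv hmono
    (fun t => G t * ENNReal.ofReal (Real.exp (-t)))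
  rw [himage] at h
  rw [h]

/-- **The law of `|z|²` in integral form**: for measurable `G : ℝ → [0,∞]`,
`𝔼 G(|z|²) = ∫_{(0,∞)} G(t) e^{−t} dt` under the standard complex Gaussian (polar coordinates
in `ℝ² ≅ ℂ`). [folklore] -/
theorem lintegral_comp_normSq_stdComplexGaussian (G : ℝ → ℝ≥0∞) (hG : Measurable G) :
    ∫⁻ z, G (‖z‖ ^ 2) ∂stdComplexGaussian =
      ∫⁻ t in Ioi (0:ℝ), G t * ENNReal.ofReal (Real.exp (-t)) := by
  have hdens : Measurable fun z : ℂ => ENNReal.ofReal (stdComplexGaussianDensity z) :=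
    ENNReal.measurable_ofReal.comp continuous_stdComplexGaussianDensity.measurable
  have hGn : Measurable fun z : ℂ => G (‖z‖ ^ 2) := hG.comp (by fun_prop)
  rw [stdComplexGaussian_eq_withDensity, lintegral_withDensity_eq_lintegral_mul _ hdens hGn]
  -- transfer to `ℝ × ℝ`
  have hvol : (volume : Measure ℂ) =
      (volume : Measure (ℝ × ℝ)).map Complex.measurableEquivRealProd.symm :=
    (Complex.volume_preserving_equiv_real_prod.symm.map_eq).symm
  rw [hvol, lintegral_map_equiv]
  simp only [Pi.mul_apply]
  have hF : ∀ p : ℝ × ℝ,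
      ENNReal.ofReal (stdComplexGaussianDensity (Complex.measurableEquivRealProd.symm p)) *
        G (‖Complex.measurableEquivRealProd.symm p‖ ^ 2) =
      ENNReal.ofReal π⁻¹ * (G (p.1 ^ 2 + p.2 ^ 2) *
        ENNReal.ofReal (Real.exp (-(p.1 ^ 2 + p.2 ^ 2)))) := by
    intro p
    have hn : ‖Complex.measurableEquivRealProd.symm p‖ ^ 2 = p.1 ^ 2 + p.2 ^ 2 := by
      rw [Complex.measurableEquivRealProd_symm_apply, Complex.sq_norm, Complex.normSq_mk]; ring
    rw [stdComplexGaussianDensity, hn, ENNReal.ofReal_mul (by positivity)]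
    ring
  simp_rw [hF]
  have hf2 : Measurable (fun a : ℝ × ℝ =>
      G (a.1 ^ 2 + a.2 ^ 2) * ENNReal.ofReal (Real.exp (-(a.1 ^ 2 + a.2 ^ 2)))) :=
    Measurable.mul (hG.comp (by fun_prop)) (by fun_prop)
  rw [lintegral_const_mul _ hf2]
  -- polar coordinates
  rw [← lintegral_comp_polarCoord_symm, polarCoord_target, Measure.volume_eq_prod,
    ← Measure.prod_restrict]
  have hpol : ∀ q : ℝ × ℝ, (polarCoord.symm q).1 ^ 2 + (polarCoord.symm q).2 ^ 2 = q.1 ^ 2 := by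
    intro q
    rw [polarCoord_symm_apply]
    have := Real.cos_sq_add_sin_sq q.2
    calc (q.1 * Real.cos q.2) ^ 2 + (q.1 * Real.sin q.2) ^ 2
        = q.1 ^ 2 * (Real.cos q.2 ^ 2 + Real.sin q.2 ^ 2) := by ring
      _ = q.1 ^ 2 := by rw [this, mul_one]
  simp_rw [hpol]
  have hf1 : Measurable fun r : ℝ =>
      ENNReal.ofReal r * (G (r ^ 2) * ENNReal.ofReal (Real.exp (-(r ^ 2)))) :=
    ENNReal.measurable_ofReal.mul ((hG.comp (by fun_prop)).mul (by fun_prop))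
  have hprod := lintegral_prod_mul (μ := (volume : Measure ℝ).restrict (Ioi 0))
    (ν := (volume : Measure ℝ).restrict (Ioo (-π) π)) hf1.aemeasurable
    (g := fun _ => (1 : ℝ≥0∞)) aemeasurable_const
  simp only [mul_one] at hprod
  have hsmul : ∀ q : ℝ × ℝ, ENNReal.ofReal q.1 • (G (q.1 ^ 2) * ENNReal.ofReal (Real.exp (-(q.1 ^ 2))))
      = ENNReal.ofReal q.1 * (G (q.1 ^ 2) * ENNReal.ofReal (Real.exp (-(q.1 ^ 2)))) :=
    fun q => rfl
  simp_rw [hsmul]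
  rw [hprod, lintegral_const, Measure.restrict_apply MeasurableSet.univ, univ_inter,
    Real.volume_Ioo, one_mul]
  -- constants: π⁻¹ · (∫ …) · 2π = ∫ … · 2
  have h2pi : ENNReal.ofReal (π - -π) = ENNReal.ofReal 2 * ENNReal.ofReal π := by
    rw [← ENNReal.ofReal_mul (by norm_num)]; congr 1; ring
  rw [h2pi]
  have hpi : ENNReal.ofReal π⁻¹ * ENNReal.ofReal π = 1 := by
    rw [← ENNReal.ofReal_mul (by positivity), inv_mul_cancel₀ Real.pi_pos.ne', ENNReal.ofReal_one]
  calc ENNReal.ofReal π⁻¹ * ((∫⁻ r in Ioi 0, ENNReal.ofReal r *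
          (G (r ^ 2) * ENNReal.ofReal (Real.exp (-(r ^ 2))))) * (ENNReal.ofReal 2 * ENNReal.ofReal π))
      = (ENNReal.ofReal π⁻¹ * ENNReal.ofReal π) * (ENNReal.ofReal 2 * ∫⁻ r in Ioi 0, ENNReal.ofReal r *
          (G (r ^ 2) * ENNReal.ofReal (Real.exp (-(r ^ 2))))) := by ring
    _ = ∫⁻ r in Ioi 0, ENNReal.ofReal (2 * r) *
          (G (r ^ 2) * ENNReal.ofReal (Real.exp (-(r ^ 2)))) := by
        rw [hpi, one_mul, ← lintegral_const_mul _ hf1]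
        refine setLIntegral_congr_fun measurableSet_Ioi fun r hr => ?_
        rw [← mul_assoc, ← ENNReal.ofReal_mul (by norm_num)]
    _ = ∫⁻ t in Ioi 0, G t * ENNReal.ofReal (Real.exp (-t)) := lintegral_Ioi_comp_sq_mul G

/-- The exponential density as the `Gamma(1,1)` density: on `t ≥ 0`, `gammaPDF 1 1 t = e^{−t}`, and
`0` for `t < 0`. [folklore] -/
theorem gammaPDF_one_one (t : ℝ) :
    gammaPDF 1 1 t = if 0 ≤ t then ENNReal.ofReal (Real.exp (-t)) else 0 := by
  rw [gammaPDF_eq]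
  split_ifs with h
  · simp [Real.Gamma_one]
  · simp

/-- **`|z|² ∼ Exp(1)`**: the law of the squared modulus of a standard complex Gaussian is the
exponential distribution with mean `1` (`gammaMeasure 1 1`). [folklore] -/
theorem stdComplexGaussian_map_normSq :
    stdComplexGaussian.map (fun z => ‖z‖ ^ 2) = gammaMeasure 1 1 := by
  have hm : Measurable fun z : ℂ => ‖z‖ ^ 2 := by fun_prop
  ext A hA
  rw [Measure.map_apply hm hA, ← lintegral_indicator_one (hm hA)]
  have hind : (fun z : ℂ => ((fun z : ℂ => ‖z‖ ^ 2) ⁻¹' A).indicator (1 : ℂ → ℝ≥0∞) z) =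
      fun z => A.indicator 1 (‖z‖ ^ 2) := by
    funext z
    by_cases h : ‖z‖ ^ 2 ∈ A
    · rw [Set.indicator_of_mem (show z ∈ (fun z : ℂ => ‖z‖ ^ 2) ⁻¹' A from h),
        Set.indicator_of_mem h]; rfl
    · rw [Set.indicator_of_notMem (show z ∉ (fun z : ℂ => ‖z‖ ^ 2) ⁻¹' A from h),
        Set.indicator_of_notMem h]
  rw [hind, lintegral_comp_normSq_stdComplexGaussian _ ((measurable_one.indicator hA))]
  rw [gammaMeasure, withDensity_apply _ hA]
  -- both sides are `∫ over A ∩ (0,∞)` of `e^{-t}` (the point `0` is null)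
  have hL : ∫⁻ t in Ioi (0:ℝ), A.indicator 1 t * ENNReal.ofReal (Real.exp (-t)) =
      ∫⁻ t in Ici (0:ℝ), A.indicator (fun t => ENNReal.ofReal (Real.exp (-t))) t := by
    rw [setLIntegral_congr Ioi_ae_eq_Ici]
    refine lintegral_congr fun t => ?_
    by_cases ht : t ∈ A <;> simp [ht]
  rw [hL, ← lintegral_indicator measurableSet_Ici]
  have hR : ∀ t, gammaPDF 1 1 t =
      (Ici (0:ℝ)).indicator (fun t => ENNReal.ofReal (Real.exp (-t))) t := by
    intro t
    rw [gammaPDF_one_one]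
    by_cases ht : 0 ≤ t
    · rw [if_pos ht, Set.indicator_of_mem (by exact ht)]
    · rw [if_neg ht, Set.indicator_of_notMem (by exact ht)]
  simp_rw [hR]
  rw [← lintegral_indicator hA]
  refine lintegral_congr fun t => ?_
  simp only [Set.indicator]
  by_cases h1 : t ∈ A <;> by_cases h2 : t ∈ Ici (0:ℝ) <;> simp [h1, h2]

/-! ### `Gamma(k,1) ∗ Exp(1) = Gamma(k+1,1)` -/

/-- `gammaPDF` is measurable (as an `ℝ≥0∞`-valued function). [folklore] -/
theorem measurable_gammaPDF (a r : ℝ) : Measurable (gammaPDF a r) :=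
  (measurable_gammaPDFReal a r).ennreal_ofReal

/-- The convolution integral: for `k > 0` and every `u`,
`∫ gammaPDF k 1 (s) · gammaPDF 1 1 (u − s) ds = gammaPDF (k+1) 1 u`
(`e^{−u} ∫₀ᵘ s^{k−1} ds / Γ(k) = u^k e^{−u} / Γ(k+1)`). [folklore] -/
theorem lintegral_gammaPDF_mul_gammaPDF_one_sub {k : ℝ} (hk : 0 < k) (u : ℝ) :
    ∫⁻ s, gammaPDF k 1 s * gammaPDF 1 1 (u - s) = gammaPDF (k + 1) 1 u := by
  have hΓ := Real.Gamma_pos_of_pos hk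
  by_cases hu : 0 ≤ u
  · -- restrict to `[0, u]`
    have hsupp : ∀ s, gammaPDF k 1 s * gammaPDF 1 1 (u - s) =
        (Icc 0 u).indicator (fun s => ENNReal.ofReal (Real.exp (-u) / Real.Gamma k) *
          ENNReal.ofReal (s ^ (k - 1))) s := by
      intro s
      by_cases hs : s ∈ Icc 0 u
      · have hs0 : 0 ≤ s := hs.1
        have hX : 0 ≤ 1 ^ k / Real.Gamma k * s ^ (k - 1) * Real.exp (-(1 * s)) := by positivity
        have hY : 0 ≤ Real.exp (-u) / Real.Gamma k := by positivity
        rw [Set.indicator_of_mem hs, gammaPDF_of_nonneg hs0, gammaPDF_one_one,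
          if_pos (sub_nonneg.2 hs.2), ← ENNReal.ofReal_mul hX, ← ENNReal.ofReal_mul hY]
        congr 1
        have he : Real.exp (-(1 * s)) * Real.exp (-(u - s)) = Real.exp (-u) := by
          rw [← Real.exp_add]; congr 1; ring
        rw [one_rpow]
        calc 1 / Real.Gamma k * s ^ (k - 1) * Real.exp (-(1 * s)) * Real.exp (-(u - s))
            = 1 / Real.Gamma k * s ^ (k - 1) * (Real.exp (-(1 * s)) * Real.exp (-(u - s))) := by ring
          _ = Real.exp (-u) / Real.Gamma k * s ^ (k - 1) := by rw [he]; ring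
      · rw [Set.indicator_of_notMem hs]
        rw [Set.mem_Icc, not_and_or, not_le, not_le] at hs
        rcases hs with hs | hs
        · rw [gammaPDF_of_neg hs, zero_mul]
        · rw [gammaPDF_one_one, if_neg (by linarith), mul_zero]
    simp_rw [hsupp]
    rw [lintegral_indicator measurableSet_Icc, lintegral_const_mul _ (by fun_prop)]
    -- `∫_{[0,u]} s^{k-1} ds = u^k / k`
    have hint : ∫⁻ s in Icc 0 u, ENNReal.ofReal (s ^ (k - 1)) = ENNReal.ofReal (u ^ k / k) := by
      have hii : IntervalIntegrable (fun s : ℝ => s ^ (k - 1)) volume 0 u :=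
        intervalIntegral.intervalIntegrable_rpow' (by linarith)
      have hio : IntegrableOn (fun s : ℝ => s ^ (k - 1)) (Icc 0 u) := by
        rw [integrableOn_Icc_iff_integrableOn_Ioc]; exact hii.1
      rw [← ofReal_integral_eq_lintegral_ofReal hio
        ((ae_restrict_iff' measurableSet_Icc).2 (ae_of_all _ fun s hs => Real.rpow_nonneg hs.1 _))]
      rw [integral_Icc_eq_integral_Ioc, ← intervalIntegral.integral_of_le hu,
        integral_rpow (Or.inl (by linarith))]
      congr 1
      have : k - 1 + 1 = k := by ring
      rw [this, Real.zero_rpow hk.ne', sub_zero]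
    rw [hint, ← ENNReal.ofReal_mul (by positivity), gammaPDF_of_nonneg hu]
    congr 1
    rw [Real.Gamma_add_one hk.ne', one_rpow, add_sub_cancel_right, one_mul]
    field_simp
  · rw [not_le] at hu
    rw [gammaPDF_of_neg hu]
    have : ∀ s, gammaPDF k 1 s * gammaPDF 1 1 (u - s) = 0 := fun s => by
      by_cases hs : s < 0
      · rw [gammaPDF_of_neg hs, zero_mul]
      · rw [gammaPDF_one_one, if_neg (by rw [not_lt] at hs; linarith), mul_zero]
    simp_rw [this, lintegral_zero]

/-- **`Gamma(k,1) ∗ Exp(1) = Gamma(k+1,1)`**: the sum of independent `Gamma(k,1)` and `Exp(1)`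
random variables is `Gamma(k+1,1)`-distributed. [folklore] -/
theorem gammaMeasure_prod_map_add_exp {k : ℝ} (hk : 0 < k) :
    ((gammaMeasure k 1).prod (gammaMeasure 1 1)).map (fun p : ℝ × ℝ => p.1 + p.2) =
      gammaMeasure (k + 1) 1 := by
  haveI := isProbabilityMeasure_gammaMeasure hk one_pos
  haveI := isProbabilityMeasure_gammaMeasure (one_pos (α := ℝ)) one_pos
  ext A hA
  have hadd : Measurable fun p : ℝ × ℝ => p.1 + p.2 := measurable_add
  rw [Measure.map_apply hadd hA, Measure.prod_apply (hadd hA)]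
  have hinner : ∀ s, gammaMeasure 1 1 (Prod.mk s ⁻¹' ((fun p : ℝ × ℝ => p.1 + p.2) ⁻¹' A)) =
      ∫⁻ u, A.indicator 1 u * gammaPDF 1 1 (u - s) := by
    intro s
    have hset : Prod.mk s ⁻¹' ((fun p : ℝ × ℝ => p.1 + p.2) ⁻¹' A) = (fun t => s + t) ⁻¹' A := rfl
    rw [hset, gammaMeasure, withDensity_apply _ (measurable_const_add s hA),
      ← lintegral_indicator (measurable_const_add s hA)]
    have : (fun t => ((fun t => s + t) ⁻¹' A).indicator (gammaPDF 1 1) t) =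
        fun t => (fun u => A.indicator 1 u * gammaPDF 1 1 (u - s)) (s + t) := by
      funext t
      show ((fun t => s + t) ⁻¹' A).indicator (gammaPDF 1 1) t =
        A.indicator 1 (s + t) * gammaPDF 1 1 (s + t - s)
      rw [add_sub_cancel_left]
      by_cases h : s + t ∈ A
      · rw [Set.indicator_of_mem (show t ∈ (fun t => s + t) ⁻¹' A from h),
          Set.indicator_of_mem h, Pi.one_apply, one_mul]
      · rw [Set.indicator_of_notMem (show t ∉ (fun t => s + t) ⁻¹' A from h),
          Set.indicator_of_notMem h, zero_mul]
    rw [this]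
    exact lintegral_add_left_eq_self (μ := (volume : Measure ℝ))
      (fun u => A.indicator 1 u * gammaPDF 1 1 (u - s)) s
  simp_rw [hinner]
  have hΦ : Measurable (Function.uncurry fun (s u : ℝ) =>
      A.indicator 1 u * gammaPDF 1 1 (u - s)) :=
    ((measurable_one.indicator hA).comp measurable_snd).mul
      ((measurable_gammaPDF 1 1).comp (measurable_snd.sub measurable_fst))
  have hH : Measurable (Function.uncurry fun (s u : ℝ) =>
      gammaPDF k 1 s * (A.indicator 1 u * gammaPDF 1 1 (u - s))) :=
    ((measurable_gammaPDF k 1).comp measurable_fst).mul hΦ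
  rw [gammaMeasure, gammaMeasure,
    lintegral_withDensity_eq_lintegral_mul _ (measurable_gammaPDF k 1) hΦ.lintegral_prod_right,
    withDensity_apply _ hA, ← lintegral_indicator hA]
  have h1 : ∀ s, ((gammaPDF k 1) * fun s => ∫⁻ u, A.indicator 1 u * gammaPDF 1 1 (u - s)) s =
      ∫⁻ u, gammaPDF k 1 s * (A.indicator 1 u * gammaPDF 1 1 (u - s)) := by
    intro s
    rw [Pi.mul_apply, lintegral_const_mul]
    exact ((measurable_one.indicator hA).mul ((measurable_gammaPDF 1 1).comp
      (measurable_id.sub measurable_const)))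
  simp_rw [h1]
  rw [lintegral_lintegral_swap hH.aemeasurable]
  refine lintegral_congr fun u => ?_
  have h2 : ∀ s, gammaPDF k 1 s * (A.indicator 1 u * gammaPDF 1 1 (u - s)) =
      A.indicator 1 u * (gammaPDF k 1 s * gammaPDF 1 1 (u - s)) := fun s => by ring
  simp_rw [h2]
  have h3 : Measurable (fun s : ℝ => gammaPDF k 1 s * gammaPDF 1 1 (u - s)) :=
    Measurable.mul (measurable_gammaPDF k 1)
      ((measurable_gammaPDF 1 1).comp (measurable_const.sub measurable_id))
  rw [lintegral_const_mul _ h3, lintegral_gammaPDF_mul_gammaPDF_one_sub hk]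
  by_cases hu : u ∈ A
  · rw [Set.indicator_of_mem hu, Set.indicator_of_mem hu, Pi.one_apply, one_mul]
  · rw [Set.indicator_of_notMem hu, Set.indicator_of_notMem hu, zero_mul]

/-! ### Sums of squared moduli of i.i.d. complex Gaussians -/

/-- **`∑_{i<n} |z_i|² ∼ Gamma(n,1)`** for i.i.d. standard complex Gaussians `z_0,…,z_{n-1}`,
`n ≥ 1`. [folklore] -/
theorem gaussianPi_map_sum_normSq {n : ℕ} (hn : 1 ≤ n) :
    (gaussianPi (Fin n)).map (fun x => ∑ i, ‖x i‖ ^ 2) = gammaMeasure n 1 := by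
  induction n, hn using Nat.le_induction with
  | base =>
    have hS : (fun x : Fin 1 → ℂ => ∑ i, ‖x i‖ ^ 2) = (fun z : ℂ => ‖z‖ ^ 2) ∘ fun x => x 0 := by
      funext x; simp
    have hsq : Measurable fun z : ℂ => ‖z‖ ^ 2 := by fun_prop
    rw [hS, ← Measure.map_map hsq (measurable_pi_apply 0), gaussianPi,
      (measurePreserving_eval (μ := fun _ : Fin 1 => stdComplexGaussian) 0).map_eq,
      stdComplexGaussian_map_normSq, Nat.cast_one]
  | succ n hn ih =>
    have hpos : (0 : ℝ) < n := by exact_mod_cast hn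
    -- split off the last coordinate
    set e := MeasurableEquiv.piFinSuccAbove (fun _ : Fin (n + 1) => ℂ) (Fin.last n) with he
    have hmp := measurePreserving_piFinSuccAbove (fun _ : Fin (n + 1) => stdComplexGaussian)
      (Fin.last n)
    have hpi : gaussianPi (Fin (n + 1)) =
        (stdComplexGaussian.prod (gaussianPi (Fin n))).map e.symm := by
      rw [gaussianPi, gaussianPi, ← hmp.symm.map_eq]
    have hS : (fun x : Fin (n + 1) → ℂ => ∑ i, ‖x i‖ ^ 2) ∘ e.symm =
        (fun q : ℝ × ℝ => q.1 + q.2) ∘ Prod.map (fun x : Fin n → ℂ => ∑ i, ‖x i‖ ^ 2)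
          (fun z : ℂ => ‖z‖ ^ 2) ∘ Prod.swap := by
      funext q
      rcases q with ⟨z, y⟩
      simp only [Function.comp_apply, he, MeasurableEquiv.piFinSuccAbove_symm_apply,
        Fin.insertNthEquiv_apply, Prod.swap_prod_mk, Prod.map_apply]
      rw [Fin.sum_univ_castSucc, Fin.insertNth_apply_same]
      congr 1
      refine Finset.sum_congr rfl fun i _ => ?_
      rw [← Fin.succAbove_last, Fin.insertNth_apply_succAbove]
    have hSm : Measurable fun x : Fin (n + 1) → ℂ => ∑ i, ‖x i‖ ^ 2 := by fun_prop
    have hSn : Measurable fun x : Fin n → ℂ => ∑ i, ‖x i‖ ^ 2 := by fun_prop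
    have hsq : Measurable fun z : ℂ => ‖z‖ ^ 2 := by fun_prop
    rw [hpi, Measure.map_map hSm e.symm.measurable, hS,
      ← Measure.map_map measurable_add ((hSn.prodMap hsq).comp measurable_swap),
      ← Measure.map_map (hSn.prodMap hsq) measurable_swap,
      Measure.prod_swap, ← Measure.map_prod_map _ _ hSn hsq, ih, stdComplexGaussian_map_normSq,
      gammaMeasure_prod_map_add_exp hpos, Nat.cast_succ]

/-- **Independent partial sums of squares.** For a standard complex Gaussian vector indexed by
`Fin n ⊕ Fin p` (`n, p ≥ 1`), the pair `(∑_{i} |z_{inl i}|², ∑_{j} |z_{inr j}|²)` has law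
`Gamma(n,1) ⊗ Gamma(p,1)`. [folklore] -/
theorem gaussianPi_sum_map_normSq_pair {n p : ℕ} (hn : 1 ≤ n) (hp : 1 ≤ p) :
    (gaussianPi (Fin n ⊕ Fin p)).map
        (fun x => (∑ i, ‖x (Sum.inl i)‖ ^ 2, ∑ j, ‖x (Sum.inr j)‖ ^ 2)) =
      (gammaMeasure n 1).prod (gammaMeasure p 1) := by
  have hmp := measurePreserving_sumPiEquivProdPi (fun _ : Fin n ⊕ Fin p => stdComplexGaussian)
  have hSn : Measurable fun x : Fin n → ℂ => ∑ i, ‖x i‖ ^ 2 := by fun_prop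
  have hSp : Measurable fun x : Fin p → ℂ => ∑ i, ‖x i‖ ^ 2 := by fun_prop
  have hF : (fun x : Fin n ⊕ Fin p → ℂ => (∑ i, ‖x (Sum.inl i)‖ ^ 2, ∑ j, ‖x (Sum.inr j)‖ ^ 2)) =
      Prod.map (fun x : Fin n → ℂ => ∑ i, ‖x i‖ ^ 2) (fun x : Fin p → ℂ => ∑ i, ‖x i‖ ^ 2) ∘
        MeasurableEquiv.sumPiEquivProdPi (fun _ : Fin n ⊕ Fin p => ℂ) := by
    funext x; rfl
  rw [hF, ← Measure.map_map (hSn.prodMap hSp) (MeasurableEquiv.measurable _), gaussianPi,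
    hmp.map_eq, ← Measure.map_prod_map _ _ hSn hSp]
  change ((gaussianPi (Fin n)).map _).prod ((gaussianPi (Fin p)).map _) = _
  rw [gaussianPi_map_sum_normSq hn, gaussianPi_map_sum_normSq hp]

end Literature.Probability.RandomMatrix
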